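import Literature.AlgebraicGeometry.Motives.CyclesPushforwardRelDimOne
import HarnessLib

/-!
# `q_* div(t) = 0` by symmetry (replacing Fulton's "Case 1" on `ℙ¹`)

Fulton, *Intersection Theory*, Prop. 1.4, proof, Case 1: "`Y = Spec(K)`, `X = ℙ¹_K` ...
`[div(r)] = [P] - d[P_∞]` ... `f_*[div(r)] = d[Y] - d[Y] = 0`".  For the proof of Prop. 1.4 (a)
over a non-affine base `Y` we only need the case `r = t` on `ℙ¹_Y → Y`, and there the explicit
computation can be replaced by a symmetry argument which this file records abstractly:

* `Literature.AlgebraicGeometry.Motives.norm_eq_of_involutive` — for a field `K`, algebra over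
  itself through an involutive automorphism `φ`, `Nm(x) = φ x`;
* `Literature.AlgebraicGeometry.Motives.map_ord_eq_zero_of_involution` — for `q : P → Y` proper
  (integral schemes locally of finite type over a field), an involution `σ` of `P` over `Y` and
  `t ∈ R(P)^*` with `σ^♯ t = t⁻¹`: **`q_* div(t) = 0`**, since
  `σ_* div(t) = div(Nm_σ t) = div(t⁻¹) = -div(t)` (Stacks 02RT for `σ`,
  `Literature.AlgebraicGeometry.Motives.map_div_eq_div_norm_holds`) and `q_* σ_* = q_*`
  (Stacks 02R5, `Literature.AlgebraicGeometry.Motives.algebraicCycleMap_comp`).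

Everything here is proved.

## References

* [Fulton1998] W. Fulton, *Intersection Theory*, 2nd ed. (1998), Prop. 1.4, proof (Case 1).
* [StacksProject] The Stacks Project, Tags 02RT, 02R5.
-/

open CategoryTheory AlgebraicGeometry Order Topology TopologicalSpace

universe u

noncomputable section

namespace Literature.AlgebraicGeometry.Motives

/-! ### Norms along an involutive automorphism -/

/-- For a field `K` viewed as an algebra over itself through an *involutive* automorphism `φ`,
the norm of `x` is `φ x`: `K` is a line with basis `1`, and `x = φ(φ x) = (φ x) • 1`.
[folklore] -/
theorem norm_eq_of_involutive {K : Type*} [Field K] (φ : K →+* K) (hφ : ∀ x, φ (φ x) = x)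
    (x : K) : letI := φ.toAlgebra; Algebra.norm K x = φ x := by
  letI alg : Algebra K K := φ.toAlgebra
  have hx : x = algebraMap K K (φ x) := (hφ x).symm
  have hrank : @Module.finrank K K _ _ alg.toModule = 1 := by
    rw [@finrank_eq_one_iff_of_nonzero' K K _ _ alg.toModule (1 : K) one_ne_zero]
    intro w
    refine ⟨φ w, ?_⟩
    rw [@Algebra.smul_def K K _ _ alg, mul_one]
    exact hφ w
  conv_lhs => rw [hx]
  rw [Algebra.norm_algebraMap, hrank, pow_one]

/-! ### The symmetry argument: `q_* div(t) = 0` when an involution over `Y` inverts `t` -/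

/-- **`q_* div(t) = 0` by symmetry.** Let `q : P → Y` be a proper morphism of integral schemes
locally of finite type over a field, `σ` an involution of `P` over `Y` (`σ ≫ q = q`, `σ ≫ σ = 𝟙`)
and `t ∈ R(P)^*` with `σ^♯ t = t⁻¹`. Then `q_* div(t) = 0`: by Stacks 02RT for the isomorphism
`σ` (`Literature.AlgebraicGeometry.Motives.map_div_eq_div_norm_holds`),
`σ_* div(t) = div(Nm_σ t) = div(σ^♯ t) = div(t⁻¹) = -div(t)`
(`Literature.AlgebraicGeometry.Motives.norm_eq_of_involutive`), while `q_* σ_* = (σ q)_* = q_*`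
(Stacks 02R5, `Literature.AlgebraicGeometry.Motives.algebraicCycleMap_comp`); hence
`q_* div(t) = -q_* div(t)`. This replaces the explicit "Case 1" (`X = ℙ¹_K`) of Fulton,
*Intersection Theory*, Prop. 1.4, proof. [cite: Fulton1998, Prop. 1.4, proof (Case 1)] -/
theorem map_ord_eq_zero_of_involution {k : Type u} [Field k] {P Y : SchemeOver k} (q : P ⟶ Y)
    (σ : P ⟶ P) [IsIntegral P.left] [IsIntegral Y.left] [LocallyOfFiniteType P.hom]
    [LocallyOfFiniteType Y.hom] [IsLocallyNoetherian P.left] [IsLocallyNoetherian Y.left]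
    [IsProper q.left] [IsIso σ.left] (hσq : σ ≫ q = q) (hσσ : σ ≫ σ = 𝟙 P) (n : ℕ)
    (hP : height (⊤ : P.left) = n) (t : P.left.functionField) (ht : t ≠ 0)
    (hσt : RatFn.functionFieldMap σ.left t = t⁻¹) (c : AlgebraicCycle P.left ℤ)
    (hc : ⇑c = fun x ↦ Scheme.ord t x) :
    AlgebraicCycle.map q.left height height c = 0 := by
  classical
  -- `σ_* div(t) = div(Nm t)` (Stacks 02RT for the isomorphism `σ`)
  have h02RT := map_div_eq_div_norm_holds σ n hP hP t ht c hc
  -- `Nm t = σ^♯ t = t⁻¹`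
  have hcongr : ∀ {f g : P.left ⟶ P.left} [IsDominant f] [IsDominant g], f = g →
      RatFn.functionFieldMap f = RatFn.functionFieldMap g := by
    intro f g _ _ h; subst h; rfl
  have hσσ' : σ.left ≫ σ.left = 𝟙 P.left := by
    rw [← Over.comp_left, hσσ]; rfl
  have hφφ : ∀ x, RatFn.functionFieldMap σ.left (RatFn.functionFieldMap σ.left x) = x := by
    intro x
    have h := RatFn.functionFieldMap_comp σ.left σ.left
    rw [hcongr hσσ', RatFn.functionFieldMap_id] at h
    exact (RingHom.congr_fun h x).symm
  have hnorm : RatFn.norm σ.left t = t⁻¹ := by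
    rw [RatFn.norm_apply, ← hσt]
    exact norm_eq_of_involutive _ hφφ t
  -- `σ_* div(t) = -div(t)`
  have hσc : AlgebraicCycle.map σ.left height height c = -c := by
    ext y
    rw [h02RT, hnorm, Function.locallyFinsuppWithin.coe_neg, Pi.neg_apply, hc]
    have h1 : Scheme.ord (t * t⁻¹) y = Scheme.ord t y + Scheme.ord t⁻¹ y :=
      Scheme.ord_mul ht (inv_ne_zero ht)
    have h2 : Scheme.ord (1 * 1 : P.left.functionField) y =
        Scheme.ord (1 : P.left.functionField) y + Scheme.ord (1 : P.left.functionField) y :=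
      Scheme.ord_mul one_ne_zero one_ne_zero
    rw [mul_one] at h2
    rw [mul_inv_cancel₀ ht] at h1
    dsimp only
    omega
  -- `q_* div(t) = q_* σ_* div(t) = -q_* div(t)`
  have hσq' : σ.left ≫ q.left = q.left := by
    rw [← Over.comp_left, hσq]
  have hcomp := algebraicCycleMap_comp σ.left q.left σ.left.isClosedMap q.left.isClosedMap c
  rw [hσc] at hcomp
  have hneg : AlgebraicCycle.map q.left height height (-c) =
      -AlgebraicCycle.map q.left height height c := by
    apply eq_neg_of_add_eq_zero_left
    rw [← algebraicCycleMap_add, neg_add_cancel, algebraicCycleMap_zero]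
  have hmapcongr : ∀ {f g : P.left ⟶ Y.left} [QuasiCompact f] [QuasiCompact g], f = g →
      AlgebraicCycle.map f height height c = AlgebraicCycle.map g height height c := by
    intro f g _ _ h; subst h; rfl
  rw [hmapcongr hσq', hneg] at hcomp
  -- `x = -x` in a torsion-free group
  ext y
  have hy := congrArg (fun d : AlgebraicCycle Y.left ℤ ↦ d y) hcomp
  simp only [Function.locallyFinsuppWithin.coe_neg, Pi.neg_apply] at hy
  simp only [Function.locallyFinsuppWithin.coe_zero, Pi.zero_apply]
  omega

end Literature.AlgebraicGeometry.Motives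

end
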